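import Mathlib
import HarnessLib
import Summits.NavierStokesRegularity.NavierStokesRegularity.Theorems.HeredityAtOne.Negative.CapStratumImpulseBalance
import Summits.NavierStokesRegularity.FluidComputer.PalasekTowerGermHostExplicit

/-!
# The germ hosts of the 19179 line push with ZERO SPATIAL MEAN — so they never feed the stratum lane
# of 19249 (Saffman (3.2.9) read on the matched germ)

Cell `ns-blowup`, seat `ns-blowup-fc-prover-3` (g8; prover, GROUP E re-point; bears_on LADDER-NS N1, route
`PalasekTowerBreakdown`, cruxes `HeredityAtOne` = item stmt-NavierStokesRegularity-19249 (NEGATIVE LANE) and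
`EpisodeBase` = item 19179 (its only registered line `slot`, hosts = the matched germ of ecbridge-3/4) — supports only).
LABEL: KERNEL bookkeeping (theorems only; no definition, no named fact; nothing asserted about either crux).

THE POINT. The 19179 line's hosts are the MATCHED GERMS of ecbridge-3/4 (`PalasekTowerMatchedGerm.lean`): for a
divergence-free profile `U ∈ C_c^∞`, the exact classical solution `germ t = α(t) U + β(t) V`, `V = P(νΔU − (U·∇)U)`
(`accel`), of the system forced by its own residual `germResid` (`isClassicalNSSolutionOn_germ`), switched off by a
time fade (`germForce`, `lineForce U σ₀ ε = germForce 1 U αhost (βhost σ₀) (1+ε) ε`). The residual is confined to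
`tsupport U` (`germResid_eq_zero_of_notMem_tsupport`). THIS FILE: **its spatial mean vanishes at every time `t ≥ 0`**,
`∫ germResid(t, x) dx = 0` (`integral_germResid_eq_zero`), hence so does the mean of every faded germ force and of
`lineForce` (`integral_germForce_eq_zero`, `integral_lineForce_eq_zero`). Consequently (this seat's unconditional
`HeredityAtOneImpulseEnergy.not_inCapStratum_of_zeroMean`, p500762): **no design whose force is a faded germ force —
in particular no host of the registered line `slot` of 19179 — has a registered stage in the capped signed swirl-free
stratum `𝒮_k` of item 19249's split** (`not_inCapStratum_of_germForce_design`, `not_inCapStratum_of_lineForce_design`):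
the two lanes are DISJOINT by theorem.

PROOF OF THE ZERO MEAN (no estimate of the pressure tail needed). Saffman's impulse law from the energy
(`IsClassicalNSSolutionOn.integral_cross_vorticity_sub_eq_of_energy`, this seat) applied to the germ itself on `[0, T]`:
`∫ x × curl(germ t) − ∫ x × curl(germ 0) = 2 ∫₀ᵗ ∫ germResid`. But `curl (germ τ) = α curl U + β curl W`
(`curl V = curl W`, `V = W − ∇π`) is compactly supported and `∫ x × curl U = 2∫U = 0`, `∫ x × curl W = 2∫W = 0`
(`W = νΔU − (U·∇)U` has zero mean: `integral_laplacian_eq_zero_of_isDivFree`, `integral_convect_self_eq_zero`), so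
`∫₀ᵗ (∫ germResid) = 0` for every `t`; the mean is continuous in `t` (compact support, joint continuity), hence `≡ 0`.

WHAT THIS IS NOT: not Navier–Stokes evidence; no verdict on 19249 or 19179; no stage is constructed — a statement about
the FORCE of the germ designs and the register's bookkeeping.

References: P. G. Saffman, *Vortex Dynamics* (1992) §3.2 (3.2.9), (3.2.11) [cite: Saffman1992, §3.2];
S. Palasek, arXiv:2605.13827 §3.3–§4 [cite: Palasek2026ElementaryModel, §3.3];
A. J. Majda, A. L. Bertozzi (2002) §1.8 Prop. 1.16 [cite: MajdaBertozziCUP2002, §1.8 Prop. 1.16].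
-/

noncomputable section

namespace Summit.NavierStokesRegularity.HeredityAtOneGermZeroMean

open Set MeasureTheory Filter Function InnerProductSpace Metric
open scoped RealInnerProductSpace ContDiff Topology ENNReal Laplacian
open Literature.Analysis.FluidPDE
open Summit.NavierStokesRegularity.FluidComputer
open Summit.NavierStokesRegularity.FluidComputer.PalasekTowerClayBridge
open Summit.NavierStokesRegularity.FluidComputer.PalasekTowerClayBridge.Germ
open Summit.NavierStokesRegularity.NavierStokesRegularity
open Summit.NavierStokesRegularity.HeredityAtOneNoSwirlStratum
open Summit.NavierStokesRegularity.HeredityAtOneImpulseEnergy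

variable {ν : ℝ} {U : EuclideanSpace ℝ (Fin 3) → EuclideanSpace ℝ (Fin 3)} {α β : ℝ → ℝ}

/-! ## §1 The vorticity of the germ is compactly supported and carries zero impulse -/

section Impulse

variable (hU : ContDiff ℝ ∞ U) (hUc : HasCompactSupport U) (hdiv : VectorCalculus.IsDivFree U)
include hU hUc

/-- `curl V = curl W`: the Leray projection only removes a gradient (`V = W − ∇π`, `curl ∇π = 0`). [folklore] -/
theorem curl_accel_eq (ν : ℝ) (x : EuclideanSpace ℝ (Fin 3)) : curl (accel ν U) x = curl (drift ν U) x := by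
  have e : accel ν U = fun y => drift ν U y - gradient (pot ν U) y := funext fun y => accel_apply ν y
  have hW : DifferentiableAt ℝ (drift ν U) x := ((contDiff_drift hU ν).differentiable (by simp)) x
  have hπ2 : ContDiff ℝ 2 (pot ν U) := (contDiff_pot hU hUc ν).of_le (by norm_cast)
  have hg : DifferentiableAt ℝ (fun y => gradient (pot ν U) y) x :=
    ((contDiff_gradient_of_contDiff_top (contDiff_pot hU hUc ν)).differentiable (by simp)) x
  rw [e, curl_sub hW hg]
  have h0 : curl (fun y => gradient (pot ν U) y) x = 0 := curl_gradient_eq_zero_holds _ hπ2 x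
  rw [h0, sub_zero]

/-- **The vorticity of a germ slice**: `curl (germ t) = α(t) curl U + β(t) curl W` pointwise. [folklore] -/
theorem curl_germ_eq (ν : ℝ) (t : ℝ) (x : EuclideanSpace ℝ (Fin 3)) :
    curl (germ ν U α β t) x = α t • curl U x + β t • curl (drift ν U) x := by
  have hdU : DifferentiableAt ℝ U x := (hU.differentiable (by simp)) x
  have hdV : DifferentiableAt ℝ (accel ν U) x := ((contDiff_accel hU hUc ν).differentiable (by simp)) x
  have hdU' : DifferentiableAt ℝ (fun y => α t • U y) x := hdU.const_smul (α t)
  have hdV' : DifferentiableAt ℝ (fun y => β t • accel ν U y) x := hdV.const_smul (β t)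
  have e : germ ν U α β t = fun y => α t • U y + β t • accel ν U y := rfl
  rw [e, curl_add hdU' hdV', curl_const_smul hdU, curl_const_smul hdV, curl_accel_eq hU hUc ν x]

omit hU hUc in
/-- `tsupport W ⊆ tsupport U` for the drift `W = νΔU − (U·∇)U`. [folklore] -/
theorem tsupport_drift_subset (ν : ℝ) : tsupport (drift ν U) ⊆ tsupport U :=
  closure_minimal (fun y hy => by
    by_contra h
    exact hy (drift_eq_zero_of_notMem_tsupport ν h)) (isClosed_tsupport U)

/-- The vorticity of a germ slice vanishes off `tsupport U`. [folklore] -/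
theorem curl_germ_eq_zero_of_notMem_tsupport (ν : ℝ) (t : ℝ) {x : EuclideanSpace ℝ (Fin 3)}
    (hx : x ∉ tsupport U) : curl (germ ν U α β t) x = 0 := by
  have h1 : curl U x = 0 := curl_eq_zero_of_notMem_tsupport hx
  have h2 : curl (drift ν U) x = 0 :=
    curl_eq_zero_of_notMem_tsupport fun h => hx (tsupport_drift_subset ν h)
  rw [curl_germ_eq hU hUc ν t x, h1, h2, smul_zero, smul_zero, add_zero]

/-- The impulse density `x × curl (germ t)` is integrable (continuous, supported in `tsupport U`). [folklore] -/
theorem integrable_cross_curl_germ (ν : ℝ) (t : ℝ) :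
    Integrable fun x => cross x (curl (germ ν U α β t) x) := by
  have hc : Continuous fun x => cross x (curl (germ ν U α β t) x) :=
    crossCLM.continuous₂.comp (continuous_id.prodMk
      (continuous_curl ((contDiff_germ hU hUc t).of_le (by norm_cast))))
  refine hc.integrable_of_hasCompactSupport (HasCompactSupport.intro hUc fun x hx => ?_)
  show cross x (curl (germ ν U α β t) x) = 0
  rw [curl_germ_eq_zero_of_notMem_tsupport hU hUc ν t hx, ← crossCLM_apply, map_zero]

include hdiv

/-- **The drift `W = νΔU − (U·∇)U` has zero mean** (`∫ΔU = 0`, `∫(U·∇)U = 0` for a divergence-free `C_c^∞`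
profile). [cite: Saffman1992, §3.2 eq. (3.2.9)] -/
theorem integral_drift_eq_zero (ν : ℝ) : ∫ x, drift ν U x = 0 := by
  have hU3 : ContDiff ℝ 3 U := hU.of_le (by norm_cast)
  have hU1 : ContDiff ℝ 1 U := hU.of_le (by norm_cast)
  have hΔc : Continuous fun x => (Δ U) x := (contDiff_laplacian (n := 0) (hU.of_le (by norm_cast))).continuous
  have hΔs : HasCompactSupport fun x => (Δ U) x :=
    HasCompactSupport.intro hUc fun x hx => laplacian_eq_zero_of_notMem_tsupport hx
  have hΔ : Integrable fun x => (Δ U) x := hΔc.integrable_of_hasCompactSupport hΔs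
  have hc2 : Continuous fun x => ‖U x‖ ^ 2 := (hU.continuous.norm).pow 2
  have h2 : Integrable fun x => ‖U x‖ ^ 2 :=
    hc2.integrable_of_hasCompactSupport
      (HasCompactSupport.intro hUc fun x hx => by simp [image_eq_zero_of_notMem_tsupport hx])
  have hcp : Continuous fun x => ‖U x‖ * ‖fderiv ℝ U x‖ :=
    (hU.continuous.norm).mul (hU.continuous_fderiv (by simp)).norm
  have hprod : Integrable fun x => ‖U x‖ * ‖fderiv ℝ U x‖ :=
    hcp.integrable_of_hasCompactSupport
      (HasCompactSupport.intro hUc fun x hx => by simp [image_eq_zero_of_notMem_tsupport hx])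
  have hconv : Integrable fun x => convect U U x :=
    (((hU.continuous_fderiv (by simp)).clm_apply hU.continuous).congr fun x => rfl).integrable_of_hasCompactSupport
      (HasCompactSupport.intro hUc fun x hx => by
        show (fderiv ℝ U x) (U x) = 0
        rw [image_eq_zero_of_notMem_tsupport hx, map_zero])
  have hνΔ : Integrable fun x => ν • (Δ U) x := hΔ.smul ν
  have e1 : ∫ x, drift ν U x = (∫ x, ν • (Δ U) x) - ∫ x, convect U U x := integral_sub hνΔ hconv
  rw [e1, integral_smul, integral_laplacian_eq_zero_of_isDivFree hU3 hdiv hΔ,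
    integral_convect_self_eq_zero hU1 hdiv h2 hprod, smul_zero, sub_zero]

/-- **Every germ slice carries ZERO hydrodynamic impulse**: `∫ x × curl (germ t) dx = 0` for all `t`
(`= α·2∫U + β·2∫W = 0` by Saffman's (3.2.11) for compactly supported fields). [cite: Saffman1992, §3.2 eq. (3.2.11)] -/
theorem integral_cross_curl_germ_eq_zero (ν : ℝ) (t : ℝ) : ∫ x, cross x (curl (germ ν U α β t) x) = 0 := by
  have hU1 : ContDiff ℝ 1 U := hU.of_le (by norm_cast)
  have hW1 : ContDiff ℝ 1 (drift ν U) := (contDiff_drift hU ν).of_le (by norm_cast)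
  have hWc : HasCompactSupport (drift ν U) := hasCompactSupport_drift hUc ν
  have hUi : Integrable U := hU.continuous.integrable_of_hasCompactSupport hUc
  have hWi : Integrable (drift ν U) := (contDiff_drift hU ν).continuous.integrable_of_hasCompactSupport hWc
  -- the two compactly supported impulse densities
  have hcU' : Continuous fun x => cross x (curl U x) :=
    crossCLM.continuous₂.comp (continuous_id.prodMk (continuous_curl hU1))
  have hcU : Integrable fun x => cross x (curl U x) :=
    hcU'.integrable_of_hasCompactSupport (HasCompactSupport.intro hUc fun x hx => by
      show cross x (curl U x) = 0
      rw [curl_eq_zero_of_notMem_tsupport hx, ← crossCLM_apply, map_zero])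
  have hcW' : Continuous fun x => cross x (curl (drift ν U) x) :=
    crossCLM.continuous₂.comp (continuous_id.prodMk (continuous_curl hW1))
  have hcW : Integrable fun x => cross x (curl (drift ν U) x) :=
    hcW'.integrable_of_hasCompactSupport (HasCompactSupport.intro hWc fun x hx => by
      show cross x (curl (drift ν U) x) = 0
      rw [curl_eq_zero_of_notMem_tsupport hx, ← crossCLM_apply, map_zero])
  have e : (fun x => cross x (curl (germ ν U α β t) x)) =
      fun x => α t • cross x (curl U x) + β t • cross x (curl (drift ν U) x) := by
    funext x
    rw [curl_germ_eq hU hUc ν t x]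
    simp only [← crossCLM_apply, map_add, map_smul]
  have i1 : Integrable fun x => α t • cross x (curl U x) := hcU.smul (α t)
  have i2 : Integrable fun x => β t • cross x (curl (drift ν U) x) := hcW.smul (β t)
  have e2 : ∫ x, (α t • cross x (curl U x) + β t • cross x (curl (drift ν U) x)) =
      (∫ x, α t • cross x (curl U x)) + ∫ x, β t • cross x (curl (drift ν U) x) := integral_add i1 i2
  rw [e, e2, integral_smul, integral_smul,
    integral_cross_curl_eq_two_smul_integral hU1 hUi hcU, integral_cross_curl_eq_two_smul_integral hW1 hWi hcW,
    integral_eq_zero_of_isDivFree_of_integrable hU1 hdiv hUi, integral_drift_eq_zero hU hUc hdiv ν,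
    smul_zero, smul_zero, smul_zero, add_zero]

end Impulse

/-! ## §2 The germ residual has zero spatial mean at every time -/

section Residual

variable (hU : ContDiff ℝ ∞ U) (hUc : HasCompactSupport U) (hdiv : VectorCalculus.IsDivFree U)
  (hα : ContDiff ℝ ∞ α) (hβ : ContDiff ℝ ∞ β)
include hU hUc hα hβ

/-- The mean `t ↦ ∫ germResid(t, x) dx` is continuous (joint continuity, support in the compact `tsupport U`).
[folklore] -/
theorem continuous_integral_germResid (ν : ℝ) : Continuous fun t => ∫ x, germResid ν U α β t x := by
  have hK : IsCompact (tsupport U) := hUc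
  have h := continuous_parametric_integral_of_continuous (μ := (volume : Measure (EuclideanSpace ℝ (Fin 3))))
    (continuous_uncurry_germResid hU hUc hα hβ (ν := ν)) hK
  refine h.congr fun t => ?_
  exact setIntegral_eq_integral_of_forall_compl_eq_zero fun x hx =>
    germResid_eq_zero_of_notMem_tsupport hU hUc t hx

include hdiv

/-- **On every slab `[0, T]` the time-integrated mean of the residual vanishes**: `∫₀ᵗ (∫ germResid) dτ = 0`,
`0 ≤ t ≤ T` — Saffman's impulse law from the energy applied to the exact solution `(germ, germPres, germResid)`,
whose slices carry zero impulse. [cite: Saffman1992, §3.2 eq. (3.2.9)] -/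
theorem intervalIntegral_integral_germResid_eq_zero (ν : ℝ) {t : ℝ} (ht : 0 ≤ t) :
    ∫ τ in (0 : ℝ)..t, ∫ x, germResid ν U α β τ x = 0 := by
  set T : ℝ := t + 1 with hTdef
  have hT : 0 < T := by linarith
  have htT : t ≤ T := by linarith
  have hsol := isClassicalNSSolutionOn_germ (ν := ν) hU hUc hα hβ hdiv hT
  -- energy level
  obtain ⟨A, hA⟩ := isCompact_Icc.exists_bound_of_continuousOn (hα.continuous.continuousOn (s := Icc 0 T))
  obtain ⟨B, hB⟩ := isCompact_Icc.exists_bound_of_continuousOn (hβ.continuous.continuousOn (s := Icc 0 T))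
  obtain ⟨C, hCt, hC⟩ := energy_germ (ν := ν) hU hUc (fun τ hτ => by simpa using hA τ hτ)
    (fun τ hτ => by simpa using hB τ hτ)
  have h2 : ∀ τ ∈ Icc 0 T, Integrable fun x => ‖germ ν U α β τ x‖ ^ 2 := fun τ _ =>
    (memLp_two_iff_integrable_sq_norm (memLp_germ hU hUc τ).1).1 (memLp_germ hU hUc τ)
  have hE : ∀ τ ∈ Icc 0 T, ∫ x, ‖germ ν U α β τ x‖ ^ 2 ≤ C.toReal := by
    intro τ hτ
    have e : ∫ x, ‖germ ν U α β τ x‖ ^ 2 = (∫⁻ x, ‖germ ν U α β τ x‖ₑ ^ 2).toReal := by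
      rw [integral_eq_lintegral_of_nonneg_ae (Eventually.of_forall fun x => sq_nonneg _)
        (h2 τ hτ).aestronglyMeasurable]
      congr 1
      refine lintegral_congr fun x => ?_
      rw [ENNReal.ofReal_pow (norm_nonneg _), ofReal_norm]
    rw [e]
    exact ENNReal.toReal_mono hCt.ne (hC τ hτ)
  -- force majorant: bounded on the compact `[0, T] × tsupport U`, zero outside
  obtain ⟨M, hM⟩ := (isCompact_Icc.prod hUc).exists_bound_of_continuousOn
    ((continuous_uncurry_germResid hU hUc hα hβ (ν := ν)).continuousOn (s := Icc 0 T ×ˢ tsupport U))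
  set F : EuclideanSpace ℝ (Fin 3) → ℝ := (tsupport U).indicator fun _ => M with hFdef
  have hF : Integrable F :=
    (integrable_indicator_iff (isClosed_tsupport U).measurableSet).2 (integrableOn_const hUc.measure_lt_top.ne)
  have hfF : ∀ τ ∈ Icc 0 T, ∀ x, ‖germResid ν U α β τ x‖ ≤ F x := by
    intro τ hτ x
    by_cases hx : x ∈ tsupport U
    · rw [hFdef, indicator_of_mem hx]; exact hM (τ, x) ⟨hτ, hx⟩
    · rw [germResid_eq_zero_of_notMem_tsupport hU hUc τ hx, norm_zero, hFdef, indicator_of_notMem hx]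
  -- the law
  have hlaw := hsol.integral_cross_vorticity_sub_eq_of_energy hT h2 hE hF hfF le_rfl ht htT
    (integrable_cross_curl_germ hU hUc ν 0) (integrable_cross_curl_germ hU hUc ν t)
  rw [integral_cross_curl_germ_eq_zero hU hUc hdiv ν t, integral_cross_curl_germ_eq_zero hU hUc hdiv ν 0,
    sub_zero, eq_comm, smul_eq_zero] at hlaw
  exact hlaw.resolve_left two_ne_zero

/-- **THE GERM RESIDUAL HAS ZERO SPATIAL MEAN AT EVERY TIME `t ≥ 0`**: `∫ germResid(t, x) dx = 0`.
[cite: Saffman1992, §3.2 eq. (3.2.9)] -/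
theorem integral_germResid_eq_zero (ν : ℝ) {t : ℝ} (ht : 0 ≤ t) : ∫ x, germResid ν U α β t x = 0 := by
  set m : ℝ → EuclideanSpace ℝ (Fin 3) := fun τ => ∫ x, germResid ν U α β τ x with hm
  have hmc : Continuous m := continuous_integral_germResid hU hUc hα hβ ν
  -- on `(0, ∞)` the primitive `∫₀ᵗ m` vanishes identically, so `m = 0` there (FTC)
  have hpos : ∀ s, 0 < s → m s = 0 := by
    intro s hs
    have hG : (fun r => ∫ τ in (0 : ℝ)..r, m τ) =ᶠ[𝓝 s] fun _ => 0 := by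
      filter_upwards [Ioi_mem_nhds hs] with r hr
      exact intervalIntegral_integral_germResid_eq_zero hU hUc hdiv hα hβ ν (le_of_lt hr)
    have hderiv : HasDerivAt (fun r => ∫ τ in (0 : ℝ)..r, m τ) (m s) s :=
      intervalIntegral.integral_hasDerivAt_right (hmc.intervalIntegrable _ _)
        (hmc.stronglyMeasurableAtFilter _ _) hmc.continuousAt
    have h0 : HasDerivAt (fun _ : ℝ => (0 : EuclideanSpace ℝ (Fin 3))) 0 s := hasDerivAt_const s 0
    exact ((h0.congr_of_eventuallyEq hG).unique hderiv).symm
  -- at `t = 0` by continuity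
  rcases eq_or_lt_of_le ht with rfl | ht'
  · have hlim : Tendsto m (𝓝[>] 0) (𝓝 (m 0)) := hmc.continuousAt.continuousWithinAt.tendsto
    have hzero : Tendsto m (𝓝[>] 0) (𝓝 0) :=
      tendsto_const_nhds.congr' (eventually_nhdsWithin_of_forall fun s hs => (hpos s hs).symm)
    exact tendsto_nhds_unique hlim hzero
  · exact hpos t ht'

/-- **Every faded germ force has zero spatial mean at every time `t ≥ 0`** (`germForce = fade • germResid`).
[cite: Palasek2026ElementaryModel, §3.3] -/
theorem integral_germForce_eq_zero (ν T w : ℝ) {t : ℝ} (ht : 0 ≤ t) :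
    ∫ x, germForce ν U α β T w t x = 0 := by
  have e : (fun x => germForce ν U α β T w t x) = fun x => Host.fade T w t • germResid ν U α β t x := rfl
  rw [e, integral_smul, integral_germResid_eq_zero hU hUc hdiv hα hβ ν ht, smul_zero]

end Residual

/-- **THE LINE FORCE OF THE `slot` HOSTS HAS ZERO SPATIAL MEAN AT EVERY TIME `t ≥ 0`**
(`lineForce U σ₀ ε = germForce 1 U αhost (βhost σ₀) (1+ε) ε`). [cite: Palasek2026ElementaryModel, §3.3] -/
theorem integral_lineForce_eq_zero (hU : ContDiff ℝ ∞ U) (hUc : HasCompactSupport U)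
    (hdiv : VectorCalculus.IsDivFree U) (σ₀ ε : ℝ) {t : ℝ} (ht : 0 ≤ t) :
    ∫ x, lineForce U σ₀ ε t x = 0 :=
  integral_germForce_eq_zero hU hUc hdiv contDiff_αhost (contDiff_βhost σ₀) 1 (1 + ε) ε ht

/-! ## §3 The two lanes are disjoint: germ-forced designs never feed the stratum of 19249 -/

section Stratum

/-- **NO GERM-FORCED DESIGN HAS A REGISTERED STAGE IN THE STRATUM `𝒮_k`** (route binder: wide rates, route margins,
unit viscosity): if the schedule's force is a faded germ force `germForce ν' U α β T w` of a divergence-free profile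
`U ∈ C_c^∞` (any `ν'`, `α`, `β` smooth, `T`, `w`), then none of its registered level-`k` stages is in `𝒮_k` —
zero-mean push, `HeredityAtOneImpulseEnergy.not_inCapStratum_of_zeroMean`. [cite: Saffman1992, §3.2 eq. (3.2.9)]
[cite: Palasek2026ElementaryModel, §4] -/
theorem not_inCapStratum_of_germForce_design {k : ℕ} {S : Schedule TowerRates.wide}
    (hU : ContDiff ℝ ∞ U) (hUc : HasCompactSupport U) (hdiv : VectorCalculus.IsDivFree U)
    (hα : ContDiff ℝ ∞ α) (hβ : ContDiff ℝ ∞ β) {ν' T w : ℝ}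
    (hS : ∀ t x, S.f t x = germForce ν' U α β T w t x)
    (s : Stage 1 TowerRates.wide S (Margins.routeG TowerRates.wide) k) : ¬ InCapStratum k S s := by
  refine not_inCapStratum_of_zeroMean s fun t ht => ?_
  have e : (fun x => S.f t x) = fun x => germForce ν' U α β T w t x := funext fun x => hS t x
  rw [e]
  exact integral_germForce_eq_zero hU hUc hdiv hα hβ ν' T w ht.1

/-- **THE 19179 `slot` LINE NEVER FEEDS THE 19249 STRATUM LANE**: a design pushed by `lineForce U σ₀ ε` (the force
of every host of the registered line `slot`, `Cruxes/EpisodeBase/Lines/slot.lean`: `ExplicitSliceRun`) has no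
registered level-`k` stage in `𝒮_k`, for any `k`. [cite: Saffman1992, §3.2 eq. (3.2.9)] [cite: Palasek2026ElementaryModel, §4] -/
theorem not_inCapStratum_of_lineForce_design {k : ℕ} {S : Schedule TowerRates.wide}
    (hU : ContDiff ℝ ∞ U) (hUc : HasCompactSupport U) (hdiv : VectorCalculus.IsDivFree U) {σ₀ ε : ℝ}
    (hS : ∀ t x, S.f t x = lineForce U σ₀ ε t x)
    (s : Stage 1 TowerRates.wide S (Margins.routeG TowerRates.wide) k) : ¬ InCapStratum k S s :=
  not_inCapStratum_of_germForce_design hU hUc hdiv contDiff_αhost (contDiff_βhost σ₀) hS s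

/-- **Hence `C′ = HeredityAtOffStratum 1` alone decides every registered level-1 stage of a `slot`-line design**
(by name, for the tenure planner: on the germ hosts item 19249 and its repaired statement coincide).
[cite: Palasek2026ElementaryModel, §4] -/
theorem heredityAtOffStratum_one_covers_lineForce_design (h : HeredityAtOffStratum 1) {S : Schedule TowerRates.wide}
    (hP : S.Pins 8 (6 / 5)) (hR : S.Rigid) (hQ : S.Quiet)
    (hU : ContDiff ℝ ∞ U) (hUc : HasCompactSupport U) (hdiv : VectorCalculus.IsDivFree U) {σ₀ ε : ℝ}
    (hS : ∀ t x, S.f t x = lineForce U σ₀ ε t x)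
    (s : Stage 1 TowerRates.wide S (Margins.routeG TowerRates.wide) 1) :
    ∃ s' : Stage 1 TowerRates.wide S (Margins.routeG TowerRates.wide) 2, s.Extends s' :=
  h S hP hR hQ s (not_inCapStratum_of_lineForce_design hU hUc hdiv hS s)

/-- **THE EXPLICIT GERM SCHEDULES OF THE `slot` LINE** (`Germ.LineGermData.schedule`, the schedule `S⋆(U, ρ, σ₀, ε, c₄)`
of the door theorem `palasekTowerBreakdown_episodeBase_of_exists_lineGerm_selfRun`; `d.schedule.f = lineForce U σ₀ ε` by
`rfl`): NONE of their registered stages, at any level, lies in the stratum `𝒮_k` of item 19249's split.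
[cite: Saffman1992, §3.2 eq. (3.2.9)] [cite: Palasek2026ElementaryModel, §4] -/
theorem not_inCapStratum_of_lineGermData {ρ σ₀ ε c₄ : ℝ} (d : Germ.LineGermData U ρ σ₀ ε c₄) {k : ℕ}
    (s : Stage 1 TowerRates.wide d.schedule (Margins.routeG TowerRates.wide) k) : ¬ InCapStratum k d.schedule s :=
  not_inCapStratum_of_lineForce_design d.smooth
    ((isCompact_closedBall (0 : EuclideanSpace ℝ (Fin 3)) ρ).of_isClosed_subset (isClosed_tsupport U) d.support)
    d.divFree (fun _ _ => rfl) s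

/-- **The abstract-slot germ schedules of the v4 line** (`Germ.LevelZeroData.schedule`, which IS the explicit schedule of
`h.lineGermData` — `LevelZeroData.schedule_eq`, `rfl`): none of their registered stages, at any level, lies in `𝒮_k`.
[cite: Saffman1992, §3.2 eq. (3.2.9)] [cite: Palasek2026ElementaryModel, §4] -/
theorem not_inCapStratum_of_levelZeroData {ρ : ℝ} (h : Germ.LevelZeroData U ρ) {c₄ : ℝ} (hc₄ : 0 < c₄)
    (hc₄' : c₄ ≤ 1) {k : ℕ} (s : Stage 1 TowerRates.wide (h.schedule c₄ hc₄ hc₄') (Margins.routeG TowerRates.wide) k) :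
    ¬ InCapStratum k (h.schedule c₄ hc₄ hc₄') s :=
  not_inCapStratum_of_lineGermData (h.lineGermData hc₄ hc₄') s

end Stratum

/-! ## §4 (v3 append) Design column for the `slot` line: every readout slice of a germ-forced stage has ZERO impulse -/

section ZeroImpulse

variable {ν' : ℝ} {R : TowerRates} {S : Schedule R} {m : Margins R} {k : ℕ}

/-- **EVERY READOUT SLICE OF A GERM-FORCED REGISTERED STAGE CARRIES ZERO HYDRODYNAMIC IMPULSE** (any viscosity, rates,
margins, level; readout `j ≤ k` with integrable density `x × ω(τ_j)`): `∫ x × ω(τ_j, x) dx = 0` — the design's force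
(a faded germ force) has zero mean at every time, and the unconditional vector ledger
`HeredityAtOneImpulseEnergy.integral_cross_curl_slice_eq_zero_of_zeroMean` (p503106). Design column for the `slot`
line of 19179: the level-`1` slice of a slot host is impulse-balanced (never a single signed vortex ring).
[cite: Saffman1992, §3.2 eqs. (3.2.8), (3.2.9)] [cite: Palasek2026ElementaryModel, §3.3] -/
theorem integral_cross_curl_slice_eq_zero_of_germForce_design
    (hU : ContDiff ℝ ∞ U) (hUc : HasCompactSupport U) (hdiv : VectorCalculus.IsDivFree U)
    (hα : ContDiff ℝ ∞ α) (hβ : ContDiff ℝ ∞ β) {ν₀ T w : ℝ} (hS : ∀ t x, S.f t x = germForce ν₀ U α β T w t x)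
    (s : Stage ν' R S m k) {j : ℕ} (hj : j ≤ k) (hI : Integrable fun x => cross x (curl (s.u (S.τ j)) x)) :
    ∫ x, cross x (curl (s.u (S.τ j)) x) = 0 := by
  refine integral_cross_curl_slice_eq_zero_of_zeroMean s hj hI fun t ht => ?_
  have e : (fun x => S.f t x) = fun x => germForce ν₀ U α β T w t x := funext fun x => hS t x
  rw [e]
  exact integral_germForce_eq_zero hU hUc hdiv hα hβ ν₀ T w ht.1

/-- **The `slot` hosts' readout slices are impulse-balanced**: for the explicit germ schedule `d.schedule` of a
`LineGermData` design, every registered stage (any viscosity, margins, level) has `∫ x × ω(τ_j) dx = 0` at every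
readout `j ≤ k` whose density is integrable. [cite: Saffman1992, §3.2 eqs. (3.2.8), (3.2.9)]
[cite: Palasek2026ElementaryModel, §3.3] -/
theorem integral_cross_curl_slice_eq_zero_of_lineGermData {ρ σ₀ ε c₄ : ℝ} (d : Germ.LineGermData U ρ σ₀ ε c₄)
    {m : Margins TowerRates.wide} (s : Stage ν' TowerRates.wide d.schedule m k) {j : ℕ} (hj : j ≤ k)
    (hI : Integrable fun x => cross x (curl (s.u (d.schedule.τ j)) x)) :
    ∫ x, cross x (curl (s.u (d.schedule.τ j)) x) = 0 :=
  integral_cross_curl_slice_eq_zero_of_germForce_design d.smooth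
    ((isCompact_closedBall (0 : EuclideanSpace ℝ (Fin 3)) ρ).of_isClosed_subset (isClosed_tsupport U) d.support)
    d.divFree contDiff_αhost (contDiff_βhost σ₀) (fun _ _ => rfl) s hj hI

end ZeroImpulse

end Summit.NavierStokesRegularity.HeredityAtOneGermZeroMean

end
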